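import Literature.MathematicalPhysics.QuantumFieldTheory.Balaban1983to89.B8Prop7GlevZd3
import Literature.MathematicalPhysics.QuantumFieldTheory.Balaban1983to89.B8IdxB8LawsB

/-!
# BalabanUVNodes ∕ N05 ([B8], `Dag.B8_main`) — THE KNIT's PROPOSITION-7 BINDER `p7` IS JUNK-INHABITED AT THE RECORD (hazard certificate, read at
# NODE 00's families): `B8SectGH.Prop7PrintedR (famB8OfRecord θ β len) (toAxialUnit ∘ val)` and the same over `IdxB8Sub θ` ∕ `IdxB8SubB θ`

Track A of `YM-PLAN.md` (cell `pub-ymgap`, HUMAN RULING D-0062), node **N05** = [Balaban1985RegularSpaces]; R134 fan-out seat `pub-ymgap-dag-n05-c` (g4).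
The N05 knits of record (`BalabanUVNodesN05SubBKnit.exists_c₁_b8LeafRS_subB_cut_of_knit_lettersRDUB`, `…N05SubBKnitZdLan.exists_c₁_b8LeafRS_subB_cut_zdLan_…`)
display the printed member `p7 : B8SectGH.Prop7PrintedR (fun j : IdxB8SubB θ => famB8OfRecordSubB θ λ.β λ.len j) (fun j => λ.toAxial j.1)` with
`λ.toAxial` FREE residual data (`Node00.CarriersB8.ResidB8.toAxial`).  THIS MODULE reads the Literature certificate
`B8Prop7GlevZd3.prop7PrintedR_zdGF3_unitAxial_comp` (the typed sentence constrains only the OUTPUT of `toAxial`; the map «(U₀, U₁) ↦ (U₀, 1)»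
satisfies it) AT NODE 00's three family shapes: over `IdxB8 θ` (`famB8OfRecord`), `IdxB8Sub θ` (`famB8OfRecordSub`) and `IdxB8SubB θ`
(`famB8OfRecordSubB`) — i.e. for EVERY residual layer `λ` the layer `λ′ := λ` with `toAxial := toAxialUnit ∘ val` satisfies the knit's `p7`
hypothesis.  CONSEQUENCE (census, for the chair's species word): a «discharge» of `p7` at a NAMED `λ` certifies nothing about [Balaban1985RegularSpaces]
Prop. 7 unless `λ.toAxial` is print's map «U′ = (U₁U₀)^u U₀⁻¹, u of (1.29) + (1.19)»; the honest object and the bookable reading are LOCATED in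
`B8Prop7GlevZd3` (module docstring (b), (c)).  HONEST FRAMING: a three-line reading; nothing of Bałaban's asserted; count-neutral; N05 NOT discharged;
one finite 𝕋⁴ programme at fixed ε — nothing continuum ∕ ℝ⁴ ∕ OS ∕ mass-gap ∕ Clay.  No `sorry`, no new definition.  Unit `pub-ymgap-dag-n05-c` (g4), 2026-08-27.
[cite: Balaban1985RegularSpaces, Prop. 7 (1.144)–(1.145) p.100 (typed sentence, junk witness at the record)]
-/

noncomputable section

namespace Summit.QuantumFields.YangMills.BalabanUVNodes.N05Prop7UnitAxial

open Literature.MathematicalPhysics.QuantumFieldTheory.Balaban1983to89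
open Literature.MathematicalPhysics.QuantumFieldTheory.Balaban1983to89.Node00
open Literature.MathematicalPhysics.QuantumFieldTheory.Balaban1983to89.B8IdxB8LawsB (IdxB8SubB famB8OfRecordSubB)
open Literature.MathematicalPhysics.QuantumFieldTheory.Balaban1983to89.B8Prop7GlevZd3 (toAxialUnit prop7PrintedR_zdGF3_unitAxial_comp)

/-- **The knit's `p7` at NODE 00's FAMILY OF RECORD `famB8OfRecord θ β len` over `IdxB8 θ` holds for the junk axial map «forget `U₁`»**
(`B8Prop7GlevZd3.prop7PrintedR_zdGF3_unitAxial_comp` at `e := Subtype.val`; `famB8OfRecord θ β len i = zdGF3 θ.𝔸 θ.L β len i.1` by definition).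
[cite: Balaban1985RegularSpaces, Prop. 7 (1.144)–(1.145) p.100 (typed sentence, junk witness at the record)] -/
theorem prop7PrintedR_famB8OfRecord_unitAxial (θ : Stage3Params) (β : ℝ) (len : B7Prop1Explicit.Site θ.D → ℝ) :
    B8SectGH.Prop7PrintedR (fun i : IdxB8 θ => famB8OfRecord θ β len i) (fun i => toAxialUnit θ.𝔸 θ.L β len i.1) :=
  prop7PrintedR_zdGF3_unitAxial_comp θ.𝔸 θ.L β len (fun i : IdxB8 θ => i.1)

/-- **… over g32's law-cut sub-index `IdxB8Sub θ`** (`famB8OfRecordSub θ β len i = famB8OfRecord θ β len i.1`).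
[cite: Balaban1985RegularSpaces, Prop. 7 (1.144)–(1.145) p.100 (typed sentence, junk witness at the record)] -/
theorem prop7PrintedR_famB8OfRecordSub_unitAxial (θ : Stage3Params) (β : ℝ) (len : B7Prop1Explicit.Site θ.D → ℝ) :
    B8SectGH.Prop7PrintedR (fun i : IdxB8Sub θ => famB8OfRecordSub θ β len i) (fun i => toAxialUnit θ.𝔸 θ.L β len i.1.1) :=
  prop7PrintedR_zdGF3_unitAxial_comp θ.𝔸 θ.L β len (fun i : IdxB8Sub θ => i.1.1)

/-- **… over the Λb-law sub-index `IdxB8SubB θ` — EXACTLY THE `p7` BINDER OF THE N05 KNITS OF RECORD** at a residual layer whose axial map is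
«forget `U₁`»: for every `λ : ResidB8 θ`, the knit's hypothesis
`p7 : B8SectGH.Prop7PrintedR (fun j : IdxB8SubB θ => famB8OfRecordSubB θ λ.β λ.len j) (fun j => λ′.toAxial j.1)` holds at
`λ′ := {λ with toAxial := fun i => toAxialUnit θ.𝔸 θ.L λ.β λ.len i.1}` (this theorem at `β := λ.β`, `len := λ.len`).  So `p7` as bound carries
content only once `ResidB8.toAxial` is pinned to print's map. [cite: Balaban1985RegularSpaces, Prop. 7 (1.144)–(1.145) p.100 (typed sentence, junk witness at the record)] -/
theorem prop7PrintedR_famB8OfRecordSubB_unitAxial (θ : Stage3Params) (β : ℝ) (len : B7Prop1Explicit.Site θ.D → ℝ) :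
    B8SectGH.Prop7PrintedR (fun j : IdxB8SubB θ => famB8OfRecordSubB θ β len j) (fun j => toAxialUnit θ.𝔸 θ.L β len j.1.1) :=
  prop7PrintedR_zdGF3_unitAxial_comp θ.𝔸 θ.L β len (fun j : IdxB8SubB θ => j.1.1)

/-- The same, packaged AT A RESIDUAL LAYER: for every `λ : ResidB8 θ` the layer with `toAxial := toAxialUnit ∘ val` (every other field of `λ`
untouched) satisfies the knit's `p7` binder over `IdxB8SubB θ`. [cite: Balaban1985RegularSpaces, Prop. 7 (1.144)–(1.145) p.100 (typed sentence, junk witness at the record)] -/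
theorem p7_binder_of_unitAxial {θ : Stage3Params} (lam : ResidB8 θ) :
    B8SectGH.Prop7PrintedR (fun j : IdxB8SubB θ => famB8OfRecordSubB θ lam.β lam.len j)
      (fun j => ({ lam with toAxial := fun i => toAxialUnit θ.𝔸 θ.L lam.β lam.len i.1 } : ResidB8 θ).toAxial j.1) :=
  prop7PrintedR_famB8OfRecordSubB_unitAxial θ lam.β lam.len

#print axioms p7_binder_of_unitAxial

end Summit.QuantumFields.YangMills.BalabanUVNodes.N05Prop7UnitAxial

end
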